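import Mathlib
import Literature.Barriers.ValiantsHypothesis.CKRST20NaturalProofsExist
import Literature.Computability.AlgebraicComplexity.RazUniversalCircuits
import Summits.ValiantsHypothesis.ValiantsHypothesis.Theorems.BarrierLeverSuccinctHittingSetsForVPPolyParametrization
import HarnessLib

/-!
# Item `BarrierLever.NaturalProofsSeparateVNP` (stmt-ValiantsHypothesis-18972), SIGN SLICE —
# part 8: Raz parametrisation of the degree-`d` slice `vpSlice ℂ n d s` (general degree)

Generalises the tree's `SuccinctHittingSetsForVP.exists_parametrization` (FSV frame `d = n`,
`SmallCircuits ℂ n b`) to CKRST's class `𝒞(n, d, s) = vpSlice ℂ n d s` (`n`-variate, total degree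
`≤ d`, fan-in-two size `≤ s`; `CKRST20NaturalProofsExist.lean`), as needed for the AS-PRINTED form of
CKRST 2020 Thm. 1.1 (degree `n^c`):

* `ParamGen.exists_parametrization_deg` — for `n, d ≥ 1` there are `p ≤ 9376 (n + d + s + 4)^21`
  and `G : monomialsDegLE n d → ℂ[y_1, …, y_p]` with coordinates of total degree `≤ 2d` whose image
  contains the coefficient vector of every `f ∈ vpSlice ℂ n d s`.

Construction (as in the `d = n` file): `s' = (d+1)(s+n+2) + d + 1` bounds the size of
`f_k · x₀^(d-k)` for each homogeneous component `f_k`, `1 ≤ k ≤ d`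
(`SqrtCheap.complexity_homogeneousComponent_le`); these are homogeneous of degree `d`, so by Raz's
universal circuit-graph with `W = 4 s' (d+1)²` slots (`RazUniversal.exists_eval_uCoeff_eq_coeff`,
Raz 2010 Prop. 3.3) their coefficient vectors are values of ONE polynomial map on the labels
`Lab (Fin n) d W`; parameters = one coordinate for the constant term plus `d + 1` copies of the labels.

References: [Raz2010] Prop. 3.2–3.3; [ForbesShpilkaVolk2018] §3; [ChatterjeeKumarRamyaSaptharishiTengse2020]
Lemma 9 (the universal circuit) and Def. 7.
-/

-- layout Summits/ValiantsHypothesis/ValiantsHypothesis forces the duplicated namespace component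
set_option linter.dupNamespace false

namespace Summit.ValiantsHypothesis.ValiantsHypothesis.Theorems.BarrierLever.NaturalProofsSeparateVNP

open Literature.Barriers.ValiantsHypothesis Literature.Computability.AlgebraicComplexity MvPolynomial
open Summit.ValiantsHypothesis.ValiantsHypothesis.Theorems.BarrierLever.SuccinctHittingSetsForVP

namespace ParamGen

/-- `f_k · x_i^(d-k)` is homogeneous of degree `d` for the degree-`k` component `f_k`, `k ≤ d`.
[folklore] -/
theorem isHomogeneous_component_mul {n d : ℕ} (f : MvPolynomial (Fin n) ℂ) (i : Fin n) {k : ℕ}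
    (hk : k ≤ d) : (homogeneousComponent k f * X i ^ (d - k)).IsHomogeneous d := by
  have h := (homogeneousComponent_isHomogeneous k f).mul ((isHomogeneous_X ℂ i).pow (d - k))
  rwa [one_mul, Nat.add_sub_cancel' hk] at h

/-- Its complexity: `L(f_k x_i^(d-k)) ≤ (d+1)(L(f)+n+2) + d + 1` for `deg f ≤ d`.
[cite: Burgisser2000, §2.1] -/
theorem complexity_component_mul_le {n d : ℕ} (f : MvPolynomial (Fin n) ℂ) (hf : f.totalDegree ≤ d)
    (i : Fin n) (k : ℕ) :
    complexity (homogeneousComponent k f * X i ^ (d - k)) ≤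
      (d + 1) * (complexity f + n + 2) + d + 1 := by
  have h1 := Summit.ValiantsHypothesis.ValiantsHypothesis.Theorems.DivisionGapZeroOneTransfer.SqrtCheap.complexity_homogeneousComponent_le
    f hf k
  rw [Fintype.card_fin] at h1
  have h2 := LowDegree.complexity_X_pow_le (n := n) i (d - k)
  calc complexity (homogeneousComponent k f * X i ^ (d - k))
      ≤ complexity (homogeneousComponent k f) + complexity (X i ^ (d - k)) + 1 :=
        complexity_mul_le_holds _ _
    _ ≤ (d + 1) * (complexity f + n + 2) + (d - k) + 1 := by omega
    _ ≤ (d + 1) * (complexity f + n + 2) + d + 1 := by omega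

/-- The parameter count is polynomial: with `s' = (d+1)(s+n+2) + d + 1` and `W = 4 s' (d+1)²`,
`1 + (d+1) · #Lab(Fin n, d, W) ≤ 9376 (n + d + s + 4)^21`. [cite: Raz2010, Prop. 3.3 (p. 158)] -/
theorem card_params_le (n d s : ℕ) :
    1 + (d + 1) * Fintype.card (RazUniversal.Lab (Fin n) d
      (4 * ((d + 1) * (s + n + 2) + d + 1) * (d + 1) ^ 2)) ≤ 9376 * (n + d + s + 4) ^ 21 := by
  generalize hs' : (d + 1) * (s + n + 2) + d + 1 = s'
  generalize hX : n + d + s + 4 = X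
  have hX1 : 1 ≤ X := by omega
  have hd1 : d + 1 ≤ X := by omega
  have hs'le : s' ≤ X ^ 2 := by
    rw [← hs', ← hX]; ring_nf
    nlinarith [Nat.zero_le (d * s), Nat.zero_le (d * n), Nat.zero_le (n * s), Nat.zero_le (n * n),
      Nat.zero_le (d * d), Nat.zero_le (s * s), Nat.zero_le n, Nat.zero_le d, Nat.zero_le s]
  have hW : 4 * s' * (d + 1) ^ 2 ≤ 4 * X ^ 4 := by
    have h2 : (d + 1) ^ 2 ≤ X ^ 2 := Nat.pow_le_pow_left hd1 2
    calc 4 * s' * (d + 1) ^ 2 ≤ 4 * X ^ 2 * X ^ 2 :=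
          Nat.mul_le_mul (Nat.mul_le_mul_left 4 hs'le) h2
      _ = 4 * X ^ 4 := by rw [mul_assoc, ← pow_add]
  have hX4 : X ≤ X ^ 4 := by
    calc X = X ^ 1 := (pow_one X).symm
      _ ≤ X ^ 4 := Nat.pow_le_pow_right hX1 (by norm_num)
  have hsum : n + d + 4 * s' * (d + 1) ^ 2 + 1 ≤ 5 * X ^ 4 := by
    have : n + d + 1 ≤ X := by omega
    omega
  have hlab : Fintype.card (RazUniversal.Lab (Fin n) d (4 * s' * (d + 1) ^ 2)) ≤ 9375 * X ^ 20 := by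
    refine (RazUniversal.card_lab_le (Fin n) d _).trans ?_
    rw [Fintype.card_fin]
    calc 3 * (n + d + 4 * s' * (d + 1) ^ 2 + 1) ^ 5 ≤ 3 * (5 * X ^ 4) ^ 5 :=
          Nat.mul_le_mul_left 3 (Nat.pow_le_pow_left hsum 5)
      _ = 9375 * X ^ 20 := by
          rw [mul_pow, ← pow_mul, ← mul_assoc]; norm_num
  calc 1 + (d + 1) * Fintype.card (RazUniversal.Lab (Fin n) d (4 * s' * (d + 1) ^ 2))
      ≤ 1 + X * (9375 * X ^ 20) := Nat.add_le_add_left (Nat.mul_le_mul hd1 hlab) 1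
    _ = 1 + 9375 * X ^ 21 := by rw [Nat.mul_left_comm, ← pow_succ']
    _ ≤ 9376 * X ^ 21 := by have : 1 ≤ X ^ 21 := Nat.one_le_pow _ _ hX1; omega

/-- **Polynomial parametrisation of the degree-`d` slice.** For `n, d ≥ 1` there are
`p ≤ 9376 (n + d + s + 4)^21` and `G : monomialsDegLE n d → ℂ[y₁,…,y_p]` with coordinates of total
degree `≤ 2d` such that the coefficient vector of every `f ∈ vpSlice ℂ n d s` (degree `≤ d`, size
`≤ s`) is a value of `G`. [cite: Raz2010, Prop. 3.3 (p. 158); ForbesShpilkaVolk2018, §3] -/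
theorem exists_parametrization_deg (n d s : ℕ) (hn : 1 ≤ n) (hd : 1 ≤ d) :
    ∃ (p : ℕ) (G : monomialsDegLE n d → MvPolynomial (Fin p) ℂ),
      p ≤ 9376 * (n + d + s + 4) ^ 21 ∧ (∀ m, (G m).totalDegree ≤ 2 * d) ∧
      ∀ f ∈ vpSlice ℂ n d s, ∃ y : Fin p → ℂ, ∀ m,
        eval y (G m) = coeff (m : Fin n →₀ ℕ) f := by
  classical
  -- parameters
  set s' := (d + 1) * (s + n + 2) + d + 1 with hs'
  set W := 4 * s' * (d + 1) ^ 2 with hW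
  let L := RazUniversal.Lab (Fin n) d W
  let P := Unit ⊕ (Fin (d + 1) × L)
  let i₀ : Fin n := ⟨0, hn⟩
  -- the shifted exponent of a monomial of degree `k`: `m + (d - k) e₀`, of degree `d`
  let sh : monomialsDegLE n d → (Fin n →₀ ℕ) := fun m =>
    (m : Fin n →₀ ℕ) + Finsupp.single i₀ (d - (m : Fin n →₀ ℕ).degree)
  let lvl : monomialsDegLE n d → Fin (d + 1) := fun m =>
    ⟨(m : Fin n →₀ ℕ).degree, Nat.lt_succ_of_le m.2⟩
  -- the map, on the abstract parameter type `P`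
  let G₀ : monomialsDegLE n d → MvPolynomial P ℂ := fun m =>
    if (m : Fin n →₀ ℕ).degree = 0 then X (Sum.inl ())
    else rename (fun l : L => (Sum.inr (lvl m, l) : P)) (RazUniversal.uCoeff ℂ (Fin n) d W (sh m))
  -- transport to `Fin p`
  let e := Fintype.equivFin P
  refine ⟨Fintype.card P, fun m => rename e (G₀ m), ?_, ?_, ?_⟩
  · -- parameter count
    have : Fintype.card P = 1 + (d + 1) * Fintype.card L := by
      simp [P, L, Fintype.card_sum, Fintype.card_prod, Fintype.card_fin]
    rw [this]
    exact card_params_le n d s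
  · -- degrees
    intro m
    refine (totalDegree_rename_le _ _).trans ?_
    simp only [G₀]
    split_ifs
    · rw [totalDegree_X]; omega
    · exact (totalDegree_rename_le _ _).trans
        ((RazUniversal.totalDegree_uCoeff_le _).trans (by omega))
  · -- universality
    intro f hf
    -- a labelling for each positive degree `k`
    have hlab : ∀ k : Fin (d + 1), ∃ y : L → ℂ, 1 ≤ (k : ℕ) →
        ∀ e, eval y (RazUniversal.uCoeff ℂ (Fin n) d W e) =
          coeff e (homogeneousComponent k f * X i₀ ^ (d - k)) := by
      intro k
      by_cases hk : 1 ≤ (k : ℕ)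
      · have hkd : (k : ℕ) ≤ d := Nat.lt_succ_iff.mp k.isLt
        have hg := isHomogeneous_component_mul (d := d) f i₀ hkd
        have hgc : complexity (homogeneousComponent (k : ℕ) f * X i₀ ^ (d - k)) ≤ s' := by
          refine (complexity_component_mul_le f hf.1 i₀ k).trans ?_
          rw [hs']
          have := hf.2
          gcongr
        obtain ⟨y, hy⟩ := RazUniversal.exists_eval_uCoeff_eq_coeff (R := ℂ) (σ := Fin n)
          (r := d) (N := W) (s := s') hd le_rfl hg hgc
        exact ⟨y, fun _ => hy⟩
      · exact ⟨fun _ => 0, fun h => absurd h hk⟩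
    choose y hy using hlab
    let Y : P → ℂ := Sum.elim (fun _ => coeff 0 f) (fun kl => y kl.1 kl.2)
    refine ⟨Y ∘ e.symm, fun m => ?_⟩
    rw [eval_rename, Function.comp_assoc, Equiv.symm_comp_self, Function.comp_id]
    simp only [G₀]
    split_ifs with h0
    · rw [eval_X]
      have hm0 : (m : Fin n →₀ ℕ) = 0 := (Finsupp.degree_eq_zero_iff _).mp h0
      simp [Y, hm0]
    · rw [eval_rename]
      have hk1 : 1 ≤ ((lvl m : Fin (d + 1)) : ℕ) := Nat.one_le_iff_ne_zero.mpr h0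
      have hcomp : Y ∘ (fun l : L => (Sum.inr (lvl m, l) : P)) = y (lvl m) := by
        funext l; simp [Y]
      rw [hcomp, hy (lvl m) hk1 (sh m)]
      simp only [sh, lvl]
      rw [PolyParametrization.coeff_mul_X_pow_shift, coeff_homogeneousComponent, if_pos rfl]

end ParamGen

end Summit.ValiantsHypothesis.ValiantsHypothesis.Theorems.BarrierLever.NaturalProofsSeparateVNP
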